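import Summits.ValiantsHypothesis.ValiantsHypothesis.Theorems.KPlusLogSqLawResolvedSmallBlocks

/-!
# KPlusLogSqLawResolvedBlockDeficit — the parity law with an explicit per-block deficit (all `N`)

Resolved (tropical, α-row) side of the K + log² programme; sequel to
`KPlusLogSqLawResolvedSmallBlocks` (`odd_steps_le_of_small_blocks`), cf. the route items
`Theses.KPlusLogSqLaw.DComb` / `ClosedWindowLaw` (stmt-ValiantsHypothesis-28100 / 28101).

For a step set of size `ℓ` write `deficit ℓ` for the FORMULA `2 ⌊(ℓ-1)/6⌋ + 2·[ℓ ≡ 5 (mod 6)]`, spelled out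
in every statement (no definition is introduced; natural subtraction;
`= 0,0,0,0,2,0,2,2,2,2,4,2,4,…` for `ℓ = 1,2,3,…`; it vanishes exactly for `ℓ ≤ 4` and `ℓ = 6`).

**Theorem (`odd_steps_le_add_deficit`).** For a two-speed word `lam : Fin N → ℤ` and ANY chain
`μ₀, …, μ_L` of finite edge sets with strictly increasing slopes,
`#{k : |μ_k ∆ μ_{k+1}| odd} ≤ N + ∑_k deficit |μ_k ∆ μ_{k+1}|`.

In particular the excess over `N` is at most twice the number of steps of size `5`, `7 … 10` or `12`,
plus four times the number of steps of size `11`, `13 … 16` or `18`, etc.; with no step of size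
`5` or `≥ 7` this is the small-block law.  No matching / block / distinctness hypothesis is used.

*Proof.*  One step (`psi_step_deficit`): with `T` = the number of moved edges that move towards their
sign, `ℓ + 1 ≤ 3T` and `Ψ(B) - Ψ(A) = 2T - ℓ` (sign potential `Ψ(S) = ∑_{e∈S} sign (lam e)`, as in the
small-block file); an `omega` computation (`deficit_key`) gives `[ℓ odd] ≤ (2T - ℓ) + deficit ℓ`.  Telescoping and
`Ψ(μ_L) - Ψ(μ_0) ≤ N` finish. ∎
-/

set_option linter.dupNamespace false

namespace Summit.ValiantsHypothesis.ValiantsHypothesis.Theorems.KPlusLogSqLaw.ResolvedBlockDeficit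

open Finset
open Summit.ValiantsHypothesis.ValiantsHypothesis.Theorems.KPlusLogSqLaw.ResolvedSmallBlocks
  (sum_sub_sum_eq_symmDiff psi_sub_psi_le)

variable {N : ℕ}

/-- The deficit formula `2 ⌊(ℓ-1)/6⌋ + 2·[ℓ ≡ 5 (mod 6)]` vanishes for block sizes `≤ 4` and `= 6`
(no definition is introduced; the formula is written out everywhere). -/
theorem deficit_eq_zero_of_small {ℓ : ℕ} (h : ℓ ≤ 4 ∨ ℓ = 6) :
    (2 * ((ℓ - 1) / 6) + if ℓ % 6 = 5 then 2 else 0) = 0 := by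
  rcases h with h | h
  · interval_cases ℓ <;> decide
  · subst h; decide

/-- The arithmetic heart: if `ℓ + 1 ≤ 3T` then `[ℓ odd] ≤ (2T - ℓ) + deficit ℓ`. -/
theorem deficit_key (ℓ : ℕ) (T : ℤ) (key : (ℓ : ℤ) + 1 ≤ 3 * T) :
    (if Odd ℓ then (1 : ℤ) else 0) ≤
      (2 * T - ℓ) + ((2 * ((ℓ - 1) / 6) + if ℓ % 6 = 5 then 2 else 0 : ℕ) : ℤ) := by
  rcases Nat.even_or_odd ℓ with ho | ho
  · rw [if_neg (Nat.not_odd_iff_even.mpr ho)]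
    obtain ⟨j, hj⟩ := ho
    split_ifs with h5
    · omega
    · push_cast
      omega
  · rw [if_pos ho]
    obtain ⟨j, hj⟩ := ho
    split_ifs with h5
    · push_cast
      omega
    · push_cast
      omega

/-- One step with an explicit deficit: if the slope strictly increases then
`[ |A ∆ B| odd ] ≤ (Ψ B - Ψ A) + deficit |A ∆ B|`. -/
theorem psi_step_deficit (lam : Fin N → ℤ) (hlam : ∀ e, lam e = 1 ∨ lam e = -1 ∨ lam e = 2 ∨ lam e = -2)
    (A B : Finset (Fin N)) (hgain : ∑ e ∈ A, lam e < ∑ e ∈ B, lam e) :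
    (if Odd (symmDiff A B).card then (1 : ℤ) else 0) ≤
      (∑ e ∈ B, Int.sign (lam e) - ∑ e ∈ A, Int.sign (lam e)) + ((2 * (((symmDiff A B).card - 1) / 6) + if (symmDiff A B).card % 6 = 5 then 2 else 0 : ℕ) : ℤ) := by
  set P := symmDiff A B with hP
  let c : Fin N → ℤ := fun e => if e ∈ B then lam e else -lam e
  let d : Fin N → ℤ := fun e => if e ∈ B then Int.sign (lam e) else -Int.sign (lam e)
  let t : Fin N → ℤ := fun e => if d e = 1 then 1 else 0
  have hgain' : 1 ≤ ∑ e ∈ P, c e := by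
    have := sum_sub_sum_eq_symmDiff lam A B
    simp only [hP]
    linarith
  have hdelta : ∑ e ∈ B, Int.sign (lam e) - ∑ e ∈ A, Int.sign (lam e) = ∑ e ∈ P, d e := by
    rw [sum_sub_sum_eq_symmDiff]
  have s2 : Int.sign 2 = 1 := by decide
  have hpt : ∀ e, 2 * c e ≤ 3 * d e + 1 ∧ d e = 2 * t e - 1 := by
    intro e
    rcases hlam e with h | h | h | h <;>
      by_cases hb : e ∈ B <;> simp [c, d, t, h, hb, s2]
  have hsum1 : 2 * ∑ e ∈ P, c e ≤ 3 * ∑ e ∈ P, d e + P.card := by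
    have : ∑ e ∈ P, 2 * c e ≤ ∑ e ∈ P, (3 * d e + 1) :=
      Finset.sum_le_sum fun e _ => (hpt e).1
    rw [← Finset.mul_sum] at this
    rw [Finset.sum_add_distrib, ← Finset.mul_sum, Finset.sum_const, nsmul_eq_mul, mul_one] at this
    linarith
  have hsum2 : ∑ e ∈ P, d e = 2 * ∑ e ∈ P, t e - P.card := by
    have : ∑ e ∈ P, d e = ∑ e ∈ P, (2 * t e - 1) := Finset.sum_congr rfl fun e _ => (hpt e).2
    rw [this, Finset.sum_sub_distrib, ← Finset.mul_sum, Finset.sum_const, nsmul_eq_mul, mul_one]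
  have ht0 : ∀ e, 0 ≤ t e := by intro e; simp only [t]; split_ifs <;> norm_num
  have hT : 0 ≤ ∑ e ∈ P, t e := Finset.sum_nonneg fun e _ => ht0 e
  rw [hdelta, hsum2]
  set T := ∑ e ∈ P, t e with hT'
  set ℓ := P.card with hℓ
  have key : (ℓ : ℤ) + 1 ≤ 3 * T := by
    have := hsum1
    rw [hsum2] at this
    linarith
  have := deficit_key ℓ T key
  linarith

/-- **Parity law with deficits.** For a two-speed word and ANY chain of edge sets with strictly
increasing slopes, `#odd steps ≤ N + ∑_k deficit |μ_k ∆ μ_{k+1}|`. -/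
theorem odd_steps_le_add_deficit (N L : ℕ) (lam : Fin N → ℤ) (μ : Fin (L + 1) → Finset (Fin N))
    (hlam : ∀ e, lam e = 1 ∨ lam e = -1 ∨ lam e = 2 ∨ lam e = -2)
    (hslope : ∀ k : Fin L, ∑ e ∈ μ k.castSucc, lam e < ∑ e ∈ μ k.succ, lam e) :
    ((Finset.univ.filter fun k : Fin L => Odd (symmDiff (μ k.castSucc) (μ k.succ)).card).card : ℤ) ≤
      N + ∑ k : Fin L, ((2 * (((symmDiff (μ k.castSucc) (μ k.succ)).card - 1) / 6) +
          if (symmDiff (μ k.castSucc) (μ k.succ)).card % 6 = 5 then 2 else 0 : ℕ) : ℤ) := by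
  have hcount : ((Finset.univ.filter fun k : Fin L =>
      Odd (symmDiff (μ k.castSucc) (μ k.succ)).card).card : ℤ) =
      ∑ k : Fin L, (if Odd (symmDiff (μ k.castSucc) (μ k.succ)).card then (1 : ℤ) else 0) := by
    rw [Finset.sum_ite, Finset.sum_const_zero, add_zero, Finset.sum_const, nsmul_eq_mul, mul_one]
  have hsteps : ∑ k : Fin L, (if Odd (symmDiff (μ k.castSucc) (μ k.succ)).card then (1 : ℤ) else 0) ≤
      ∑ k : Fin L, ((∑ e ∈ μ k.succ, Int.sign (lam e) - ∑ e ∈ μ k.castSucc, Int.sign (lam e)) +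
        ((2 * (((symmDiff (μ k.castSucc) (μ k.succ)).card - 1) / 6) +
          if (symmDiff (μ k.castSucc) (μ k.succ)).card % 6 = 5 then 2 else 0 : ℕ) : ℤ)) :=
    Finset.sum_le_sum fun k _ => psi_step_deficit lam hlam _ _ (hslope k)
  rw [Finset.sum_add_distrib] at hsteps
  let g : ℕ → ℤ := fun i =>
    if h : i ≤ L then ∑ e ∈ μ ⟨i, Nat.lt_succ_of_le h⟩, Int.sign (lam e) else 0
  have htel : ∑ k : Fin L, (∑ e ∈ μ k.succ, Int.sign (lam e) - ∑ e ∈ μ k.castSucc, Int.sign (lam e)) =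
      g L - g 0 := by
    have hfun : ∀ k : Fin L,
        ∑ e ∈ μ k.succ, Int.sign (lam e) - ∑ e ∈ μ k.castSucc, Int.sign (lam e) = g (k + 1) - g k := by
      intro k
      have hk1 : (k : ℕ) + 1 ≤ L := k.isLt
      have hk0 : (k : ℕ) ≤ L := k.isLt.le
      simp only [g, dif_pos hk1, dif_pos hk0]
      congr 2
    rw [Finset.sum_congr rfl fun k _ => hfun k]
    rw [Fin.sum_univ_eq_sum_range (fun i => g (i + 1) - g i) L, Finset.sum_range_sub]
  have hrange : g L - g 0 ≤ N := by
    simp only [g, dif_pos (le_refl L), dif_pos (Nat.zero_le L)]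
    exact psi_sub_psi_le lam _ _
  rw [hcount]
  linarith

end Summit.ValiantsHypothesis.ValiantsHypothesis.Theorems.KPlusLogSqLaw.ResolvedBlockDeficit
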